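import Summits.KontsevichZagierPeriods.KontsevichZagierPeriods.Theorems.SoloBlindQuarticR
import Summits.KontsevichZagierPeriods.KontsevichZagierPeriods.Theorems.SoloBlindQuarticSecondPrep
import HarnessLib

/-!
# Quartic family, second kind, pattern `(½+y, 1-4y, ½+3y)` — preparations

Sol Binde (solo-blind track), 2026-08-20.

Third second-kind splitting of the Aoki–Shioda quartic family on the quartic correspondence of
`SoloBlindQuarticPrep` (`D = m(m²-m+1)`, `A = 1-D`, `Φ = D³/A⁴`; branches `φ_A`, `φ_B`, `ψ`).
With the common factor `Λ = Φ^{y} D^{-1/2}` the three Beta integrands pull back to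

* `β(1-4y, ½+3y)` along `φ_A`  ↦ `G_A = Λ·(3m²-2m+1)`,
* `β(½+y, 1-4y)` along `φ_B`   ↦ `G_B = Λ·m(m²-2m+3)/(m²-m+1)`,
* `β(½+3y, 1-y)` along `ψ`     ↦ `G_C = 64^{y}·Λ·2(1+m)(1-m)³/(1+m²)²`,

and, exactly as for `betaQ_quarticSecond`, there is NO pointwise identity but ONE exact
correction: with the explicit algebraic primitive

  `P(m) = Λ · m(m⁴-2m²+4m-3)/(1+m²) = -m^{3y+1/2}(1-m)^{1-4y}(m²-m+1)^{3y-1/2}(m³+m²-m+3)/(1+m²)^{4y+1}`,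

which is continuous on `[0,1]` and vanishes at both ends for `0 < y < 1/4`, one has on `(0,1)`

  `P' = ((1-6y)/2)·G_B + ((1-2y)/2)·G_A - (1+4y)·64^{-y}·G_C`

(found by exact rational linear algebra).  This file: the pull-backs, integrability,
semialgebraicity on the open interval, the primitive and its derivative.  The assembly in `Q`
is `SoloBlindQuarticS3`.
-/

open MeasureTheory Set Real MvPolynomial
open Literature.NumberTheory.Transcendental
open Literature.NumberTheory.Transcendental.KZ
open Literature.NumberTheory.Transcendental.KZ.IntegralRep

noncomputable section

namespace Summit.KontsevichZagierPeriods.KontsevichZagierPeriods.Theorems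

namespace SoloBlind

variable {y : ℚ}

/-! ## The common factor, the pulled-back integrands, the exact integrand, the primitive -/

/-- `Λ(y,m) = Φ^{y} D^{-1/2}`. -/
def qiL (y : ℚ) (m : ℝ) : ℝ := quPhi m ^ (y : ℝ) * quD m ^ (-(1 / 2 : ℝ))

/-- `G_A = Λ·(3m²-2m+1)`. -/
def qiGA (y : ℚ) (m : ℝ) : ℝ := qiL y m * (3 * m ^ 2 - 2 * m + 1)

/-- `G_B = Λ·m(m²-2m+3)/(m²-m+1)`. -/
def qiGB (y : ℚ) (m : ℝ) : ℝ := qiL y m * (m * (m ^ 2 - 2 * m + 3)) / (m ^ 2 - m + 1)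

/-- `G_C = 64^{y}·Λ·2(1+m)(1-m)³/(1+m²)²`. -/
def qiGC (y : ℚ) (m : ℝ) : ℝ :=
  (64:ℝ) ^ (y : ℝ) * (qiL y m * (2 * (1 + m) * (1 - m) ^ 3) / (1 + m ^ 2) ^ 2)

/-- The exact integrand `P' = ((1-6y)/2)G_B + ((1-2y)/2)G_A - (1+4y)64^{-y}G_C` on `(0,1)`,
extended by `0`. -/
def qiE (y : ℚ) (m : ℝ) : ℝ :=
  if m ∈ Ioo (0:ℝ) 1 then
    (((-(1 + 4 * y) : ℚ)) : ℝ) * (64:ℝ) ^ (-(y : ℝ)) * qiGC y m +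
      (((((1 - 6 * y) / 2 : ℚ)) : ℝ) * qiGB y m + ((((1 - 2 * y) / 2 : ℚ)) : ℝ) * qiGA y m)
  else 0

/-- The primitive (continuous form)
`P = -m^{3y+1/2}(1-m)^{1-4y}(m²-m+1)^{3y-1/2}(m³+m²-m+3)/(1+m²)^{4y+1}`. -/
def qiP (y : ℚ) (m : ℝ) : ℝ :=
  -(m ^ (3 * (y : ℝ) + 1 / 2) * (1 - m) ^ (1 - 4 * (y : ℝ)) *
      ((m ^ 2 - m + 1) ^ (3 * (y : ℝ) - 1 / 2) * (m ^ 3 + m ^ 2 - m + 3))) /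
    (1 + m ^ 2) ^ (4 * (y : ℝ) + 1)

/-! ## Keys: the inverse square roots in `D^{-1/2}` form -/

/-- `φ_B^{-1/2} = (m²-m+1)·D^{-1/2}/m` on `(0,1)`. -/
theorem qi_halfB {m : ℝ} (hm : m ∈ Ioo (0:ℝ) 1) :
    quB m ^ (-(1 / 2 : ℝ)) = (m ^ 2 - m + 1) * quD m ^ (-(1 / 2 : ℝ)) / m := by
  have h0 := hm.1.ne'
  have hw := (Real.sqrt_pos.mpr (quD_pos hm)).ne'
  rw [qt_sqrtB hm, Real.rpow_neg (quD_pos hm).le, ← Real.sqrt_eq_rpow]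
  field_simp

/-- `ψ^{-1/2} = (1+m²)·D^{-1/2}/2` on `(0,1)`. -/
theorem qi_halfS {m : ℝ} (hm : m ∈ Ioo (0:ℝ) 1) :
    quS m ^ (-(1 / 2 : ℝ)) = (1 + m ^ 2) * quD m ^ (-(1 / 2 : ℝ)) / 2 := by
  have hw := (Real.sqrt_pos.mpr (quD_pos hm)).ne'
  rw [qt_sqrtS hm, Real.rpow_neg (quD_pos hm).le, ← Real.sqrt_eq_rpow]
  field_simp

/-! ## The pull-back identities -/

/-- **Pull-back along `φ_A`:** `G_A = σ^{-4y}(1-σ)^{3y-1/2}|φ_A'|`, `σ = φ_A(m)`. -/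
theorem qi_pullA (y : ℚ) {m : ℝ} (hm : m ∈ Ioo (0:ℝ) 1) :
    qiGA y m = betaFun (1 - 4 * y) (1 / 2 + 3 * y) (quA m) * |quA' m| := by
  have hA := quA_pos hm
  have hD := quD_pos hm
  rw [betaFun, show (((1 - 4 * y : ℚ)) : ℝ) - 1 = ((-4:ℤ) : ℝ) * (y : ℝ) + 0 by push_cast; ring,
    show (((1 / 2 + 3 * y : ℚ)) : ℝ) - 1 = ((3:ℤ) : ℝ) * (y : ℝ) + (-(1 / 2 : ℝ)) by
      push_cast; ring,
    one_sub_quA, qu_master hA hD, qu_keyA hm, Real.rpow_zero, abs_quA']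
  unfold qiGA qiL
  ring

/-- **Pull-back along `φ_B`:** `G_B = σ^{y-1/2}(1-σ)^{-4y}|φ_B'|`, `σ = φ_B(m)`. -/
theorem qi_pullB (y : ℚ) {m : ℝ} (hm : m ∈ Ioo (0:ℝ) 1) :
    qiGB y m = betaFun (1 / 2 + y) (1 - 4 * y) (quB m) * |quB' m| := by
  have hB := quB_mem hm
  have h1B : 0 < 1 - quB m := by linarith [hB.2]
  have he := (ReflectionThird.sq_sub_add_one_pos m).ne'
  have h0 := hm.1.ne'
  rw [betaFun, show (((1 / 2 + y : ℚ)) : ℝ) - 1 = ((1:ℤ) : ℝ) * (y : ℝ) + (-(1 / 2 : ℝ)) by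
      push_cast; ring,
    show (((1 - 4 * y : ℚ)) : ℝ) - 1 = ((-4:ℤ) : ℝ) * (y : ℝ) + 0 by push_cast; ring,
    qu_master hB.1 h1B, qu_keyB hm, Real.rpow_zero, qi_halfB hm, abs_of_pos (quB'_pos hm)]
  have he2 : m * (m - 1) + 1 ≠ 0 := by
    have : 0 < m * (m - 1) + 1 := by nlinarith [sq_nonneg (m - 1 / 2)]
    exact this.ne'
  unfold qiGB qiL quB'
  field_simp

/-- **Pull-back along `ψ`:** `G_C = s^{3y-1/2}(1-s)^{-y}|ψ'|`, `s = ψ(m)`. -/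
theorem qi_pullC (y : ℚ) {m : ℝ} (hm : m ∈ Ioo (0:ℝ) 1) :
    qiGC y m = betaFun (1 / 2 + 3 * y) (1 - y) (quS m) * |quS' m| := by
  have hS := quS_mem hm
  have h1S := one_sub_quS_pos hm
  have hΦ := quPhi_pos hm
  have hP : (1:ℝ) + m ^ 2 ≠ 0 := by positivity
  rw [betaFun, show (((1 / 2 + 3 * y : ℚ)) : ℝ) - 1 = ((3:ℤ) : ℝ) * (y : ℝ) + (-(1 / 2 : ℝ)) by
      push_cast; ring,
    show (((1 - y : ℚ)) : ℝ) - 1 = ((-1:ℤ) : ℝ) * (y : ℝ) + 0 by push_cast; ring,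
    qu_master hS.1 h1S, qu_keyC hm, Real.mul_rpow (by norm_num) hΦ.le, Real.rpow_zero,
    qi_halfS hm, abs_of_pos (quS'_pos hm)]
  unfold qiGC qiL quS'
  field_simp
  ring

/-! ## Integrability -/

/-- `G_A` is integrable on `(0,1)` for `0 < y < 1/4`. -/
theorem integrableOn_qiGA (y : ℚ) (hy : 0 < y) (hy4 : 4 * y < 1) :
    IntegrableOn (qiGA y) (Ioo 0 1) := by
  have h := integrableOn_betaFun (1 - 4 * y) (1 / 2 + 3 * y) (by linarith) (by positivity)
  rw [image_quA, integrableOn_image_iff_integrableOn_abs_deriv_smul measurableSet_Ioo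
    (fun m _ => (hasDerivAt_quA m).hasDerivWithinAt) injOn_quA] at h
  exact h.congr_fun (fun m hm => by simp only [smul_eq_mul]; rw [mul_comm, ← qi_pullA y hm])
    measurableSet_Ioo

/-- `G_B` is integrable on `(0,1)` for `0 < y < 1/4`. -/
theorem integrableOn_qiGB (y : ℚ) (hy : 0 < y) (hy4 : 4 * y < 1) :
    IntegrableOn (qiGB y) (Ioo 0 1) := by
  have h := integrableOn_betaFun (1 / 2 + y) (1 - 4 * y) (by positivity) (by linarith)
  rw [image_quB, integrableOn_image_iff_integrableOn_abs_deriv_smul measurableSet_Ioo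
    (fun m _ => (hasDerivAt_quB m).hasDerivWithinAt) injOn_quB] at h
  exact h.congr_fun (fun m hm => by simp only [smul_eq_mul]; rw [mul_comm, ← qi_pullB y hm])
    measurableSet_Ioo

/-- `G_C` is integrable on `(0,1)` for `0 < y < 1`. -/
theorem integrableOn_qiGC (y : ℚ) (hy : 0 < y) (hy1 : y < 1) :
    IntegrableOn (qiGC y) (Ioo 0 1) := by
  have h := integrableOn_betaFun (1 / 2 + 3 * y) (1 - y) (by positivity) (by linarith)
  rw [image_quS, integrableOn_image_iff_integrableOn_abs_deriv_smul measurableSet_Ioo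
    (fun m _ => (hasDerivAt_quS m).hasDerivWithinAt) injOn_quS] at h
  exact h.congr_fun (fun m hm => by simp only [smul_eq_mul]; rw [mul_comm, ← qi_pullC y hm])
    measurableSet_Ioo

/-! ## Semialgebraicity on the open interval -/

/-- `Φ^{y} · D^{-1/2} · p(m) / r(m)` is `ℚ`-semialgebraic on `(0,1)` for polynomials `p`, `r`
with `r ≠ 0` there. -/
theorem sa_qi_shape (y : ℚ) (p r : MvPolynomial (Fin 1) ℚ)
    (hr : ∀ v ∈ line (Ioo (0:ℝ) 1), aeval v r ≠ 0) :
    IsSemialgebraicFunOn ℚ (line (Ioo (0:ℝ) 1))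
      (fun v : Fin 1 → ℝ =>
        quPhi (v 0) ^ (y : ℝ) * quD (v 0) ^ (-(1 / 2 : ℝ)) * aeval v p / aeval v r) := by
  have hD : IsSemialgebraicFunOn ℚ (line (Ioo (0:ℝ) 1))
      (fun v : Fin 1 → ℝ => quD (v 0) ^ (-(1 / 2 : ℝ))) :=
    (sa_quD_rpow (-(1 / 2))).congr fun v _ => by push_cast; rfl
  exact IsSemialgebraicFunOn.div
    (IsSemialgebraicFunOn.mul_holds (IsSemialgebraicFunOn.mul_holds (sa_quPhi_rpow y) hD)
      (isSemialgebraicFunOn_aeval mix_line_sa p))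
    (isSemialgebraicFunOn_aeval mix_line_sa r) hr

/-- `G_A` is `ℚ`-semialgebraic on `(0,1)`. -/
theorem sa_qiGA (y : ℚ) :
    IsSemialgebraicFunOn ℚ (line (Ioo (0:ℝ) 1)) (fun v : Fin 1 → ℝ => qiGA y (v 0)) :=
  (sa_qi_shape y (3 * X 0 ^ 2 - 2 * X 0 + 1) 1 fun v _ => by simp).congr
    fun v _ => by simp [qiGA, qiL]

/-- `G_B` is `ℚ`-semialgebraic on `(0,1)`. -/
theorem sa_qiGB (y : ℚ) :
    IsSemialgebraicFunOn ℚ (line (Ioo (0:ℝ) 1)) (fun v : Fin 1 → ℝ => qiGB y (v 0)) :=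
  (sa_qi_shape y (X 0 * (X 0 ^ 2 - 2 * X 0 + 3)) (X 0 ^ 2 - X 0 + 1) fun v _ => by
      simpa using (ReflectionThird.sq_sub_add_one_pos (v 0)).ne').congr
    fun v _ => by simp [qiGB, qiL, mul_div_assoc]

/-- `G_C` is `ℚ`-semialgebraic on `(0,1)`. -/
theorem sa_qiGC (y : ℚ) :
    IsSemialgebraicFunOn ℚ (line (Ioo (0:ℝ) 1)) (fun v : Fin 1 → ℝ => qiGC y (v 0)) :=
  (IsSemialgebraicFunOn.mul_holds
    (isSemialgebraicFunOn_const_of_isAlgebraic mix_line_sa (qu_isAlgebraic_rpow y))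
    (sa_qi_shape y (2 * (1 + X 0) * (1 - X 0) ^ 3) ((1 + X 0 ^ 2) ^ 2) fun v _ => by
      have : (0:ℝ) < (1 + v 0 ^ 2) ^ 2 := by positivity
      simpa using this.ne')).congr fun v _ => by simp [qiGC, qiL, mul_div_assoc]

/-- The exact integrand is `ℚ`-semialgebraic on the OPEN interval. -/
theorem sa_qiE_Ioo (y : ℚ) :
    IsSemialgebraicFunOn ℚ (line (Ioo (0:ℝ) 1)) (fun v : Fin 1 → ℝ => qiE y (v 0)) := by
  refine (((isSemialgebraicFunOn_const_of_isAlgebraic mix_line_sa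
      (isAlgebraic_rat ℚ (-(1 + 4 * y)))).mul_holds
      ((isSemialgebraicFunOn_const_of_isAlgebraic mix_line_sa
        (qu_isAlgebraic_rpow (-y))).mul_holds (sa_qiGC y))).add_holds
    (((isSemialgebraicFunOn_const_of_isAlgebraic mix_line_sa
      (isAlgebraic_rat ℚ ((1 - 6 * y) / 2))).mul_holds (sa_qiGB y)).add_holds
      ((isSemialgebraicFunOn_const_of_isAlgebraic mix_line_sa
        (isAlgebraic_rat ℚ ((1 - 2 * y) / 2))).mul_holds (sa_qiGA y)))).congr fun v hv => ?_
  have hv' : v 0 ∈ Ioo (0:ℝ) 1 := hv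
  simp only [qiE, if_pos hv', Pi.add_apply, Pi.mul_apply]
  push_cast
  ring

/-! ## The primitive -/

/-- `P(0) = 0`. -/
theorem qiP_zero (hy : 0 < y) : qiP y 0 = 0 := by
  have h : (3 * (y : ℝ) + 2⁻¹) ≠ 0 := by positivity
  simp [qiP, Real.zero_rpow h]

/-- `P(1) = 0` (`y < 1/4`). -/
theorem qiP_one (hy4 : 4 * y < 1) : qiP y 1 = 0 := by
  have h : (1 - 4 * (y : ℝ)) ≠ 0 := by
    have : (4 * y : ℝ) < 1 := by exact_mod_cast hy4
    linarith
  simp [qiP, Real.zero_rpow h]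

/-- `P` is continuous (`0 < y < 1/4`). -/
theorem continuous_qiP (hy : 0 < y) (hy4 : 4 * y < 1) : Continuous (qiP y) := by
  have h1 : (0:ℝ) ≤ 3 * (y : ℝ) + 1 / 2 := by positivity
  have h2 : (0:ℝ) ≤ 1 - 4 * (y : ℝ) := by
    have : (4 * y : ℝ) < 1 := by exact_mod_cast hy4
    linarith
  unfold qiP
  refine Continuous.div ?_ ?_ fun m => (Real.rpow_pos_of_pos (by positivity) _).ne'
  · exact (((Continuous.rpow_const continuous_id fun _ => Or.inr h1).mul
      (Continuous.rpow_const (by fun_prop) fun _ => Or.inr h2)).mul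
      ((Continuous.rpow_const (by fun_prop) fun m =>
        Or.inl (ReflectionThird.sq_sub_add_one_pos m).ne').mul (by fun_prop))).neg
  · exact Continuous.rpow_const (by fun_prop) fun m => Or.inl (by positivity)

/-- On `(0,1)`: `P = Λ · m(m⁴-2m²+4m-3)/(1+m²)`. -/
theorem qiP_eq {m : ℝ} (hm : m ∈ Ioo (0:ℝ) 1) :
    qiP y m = qiL y m * (m * (m ^ 4 - 2 * m ^ 2 + 4 * m - 3) / (1 + m ^ 2)) := by
  have hA := quA_pos hm
  have hD := quD_pos hm
  have h0 := hm.1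
  have h1 : (0:ℝ) < 1 - m := by linarith [hm.2]
  have he := ReflectionThird.sq_sub_add_one_pos m
  have h2 : (0:ℝ) < 1 + m ^ 2 := by positivity
  unfold qiL
  rw [show quPhi m = quD m ^ 3 / quA m ^ 4 from rfl,
    Real.div_rpow (pow_nonneg hD.le 3) (pow_nonneg hA.le 4), ← Real.rpow_natCast (quD m) 3,
    ← Real.rpow_mul hD.le, ← Real.rpow_natCast (quA m) 4, ← Real.rpow_mul hA.le,
    show quA m = (1 - m) * (1 + m ^ 2) from rfl, show quD m = m * (m ^ 2 - m + 1) from rfl,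
    Real.mul_rpow h1.le h2.le, Real.mul_rpow h0.le he.le, Real.mul_rpow h0.le he.le]
  unfold qiP
  rw [show (3 * (y : ℝ) + 1 / 2) = (3 * (y : ℝ) + 1) + (-(1 / 2 : ℝ)) by ring, Real.rpow_add h0,
    Real.rpow_add_one h0.ne', show (3 * (y : ℝ) - 1 / 2) = 3 * (y : ℝ) + (-(1 / 2 : ℝ)) by ring,
    Real.rpow_add he, Real.rpow_sub h1, Real.rpow_one, Real.rpow_add_one h2.ne']
  push_cast
  have hp1 := Real.rpow_pos_of_pos h2 (4 * (y:ℝ))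
  have hp2 := Real.rpow_pos_of_pos h0 (3 * (y:ℝ))
  have hp3 := Real.rpow_pos_of_pos he (3 * (y:ℝ))
  have hp4 := Real.rpow_pos_of_pos h1 (4 * (y:ℝ))
  have hp5 := Real.rpow_pos_of_pos h0 (-(1 / 2 : ℝ))
  have hp6 := Real.rpow_pos_of_pos he (-(1 / 2 : ℝ))
  field_simp
  ring

/-- `Λ' = Λ·(yΦ'/Φ - D'/(2D))` on `(0,1)`. -/
theorem hasDerivAt_qiL {m : ℝ} (hm : m ∈ Ioo (0:ℝ) 1) :
    HasDerivAt (qiL y) (qiL y m * ((y : ℝ) * (quPhi' m / quPhi m) -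
      (3 * m ^ 2 - 2 * m + 1) / (2 * quD m))) m := by
  have hΦ := quPhi_pos hm
  have hD := quD_pos hm
  refine (((hasDerivAt_quPhi hm).rpow_const (p := (y : ℝ)) (Or.inl hΦ.ne')).mul
    ((hasDerivAt_quD m).rpow_const (p := -(1 / 2 : ℝ)) (Or.inl hD.ne'))).congr_deriv ?_
  unfold qiL
  rw [Real.rpow_sub_one hΦ.ne', Real.rpow_sub_one hD.ne']
  field_simp
  ring

/-- **`P' = ((1-6y)/2)G_B + ((1-2y)/2)G_A - (1+4y)64^{-y}G_C` on `(0,1)`** — the Newton–Leibniz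
identity of the third second-kind quartic splitting. -/
theorem hasDerivAt_qiP {m : ℝ} (hm : m ∈ Ioo (0:ℝ) 1) : HasDerivAt (qiP y) (qiE y m) m := by
  obtain ⟨h0, h1⟩ := hm
  have hΦ := quPhi_pos ⟨h0, h1⟩
  have hA := (quA_pos ⟨h0, h1⟩).ne'
  have hD := (quD_pos ⟨h0, h1⟩).ne'
  have he := (ReflectionThird.sq_sub_add_one_pos m).ne'
  have h2 : (1:ℝ) + m ^ 2 ≠ 0 := by positivity
  have h2' : (1:ℝ) + m * m ≠ 0 := by positivity
  have h64 : (64:ℝ) ^ (y : ℝ) ≠ 0 := by positivity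
  have hid := hasDerivAt_id' m
  have hsq := hid.mul hid
  have hN := (((hsq.mul hsq).sub (hsq.const_mul 2)).add (hid.const_mul 4)).sub_const 3
  have hρ := (hid.mul hN).div (hsq.const_add 1) h2'
  have hF : qiP y =ᶠ[nhds m] fun v => qiL y v *
      (v * (v * v * (v * v) - 2 * (v * v) + 4 * v - 3) / (1 + v * v)) :=
    Filter.eventually_iff_exists_mem.mpr ⟨Ioo 0 1, Ioo_mem_nhds h0 h1, fun v hv => by
      rw [qiP_eq hv]; ring⟩
  refine ((((hasDerivAt_qiL ⟨h0, h1⟩).mul hρ).congr_of_eventuallyEq hF)).congr_deriv ?_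
  simp only [Pi.mul_apply, Pi.add_apply, Pi.sub_apply, Pi.div_apply]
  rw [qiE, if_pos ⟨h0, h1⟩]
  simp only [qiGA, qiGB, qiGC]
  rw [Real.rpow_neg (by norm_num : (0:ℝ) ≤ 64) (y : ℝ)]
  set L := qiL y m with hL
  have key : L * ((y : ℝ) * (quPhi' m / quPhi m) - (3 * m ^ 2 - 2 * m + 1) / (2 * quD m)) =
      L * ((y : ℝ) * ((3 * m ^ 2 - 2 * m + 1) * (3 * quA m + 4 * quD m) / (quA m * quD m)) -
        (3 * m ^ 2 - 2 * m + 1) / (2 * quD m)) := by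
    rw [← quPhi'_div ⟨h0, h1⟩]
  rw [key]
  unfold quA quD at *
  have h1m : (1:ℝ) - m ≠ 0 := by linarith
  push_cast
  set q := m ^ 2 - m + 1 with hq
  field_simp
  rw [hq]
  ring

end SoloBlind

end Summit.KontsevichZagierPeriods.KontsevichZagierPeriods.Theorems
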